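import Mathlib
import HarnessLib

/-!
# ForsterIsotropicPosition

Topic `Literature/Computability/Complexity`. Named literature fact(s) relocated by the gate from `Summits/QuantumAdvantage/QuantumAdvantage/Theorems/HankelLiftBeyondRectanglesForsterReduction.lean`
(accept-time relocation of `[cite]`d propositions written inline in a Summits proposal; human ruling 2026-08-15).
Sources: Forster2002.

* `Literature.Computability.Complexity.ForsterIsotropicPosition`
-/

namespace Literature.Computability.Complexity

open Finset Real Matrix

/-- **Forster's Theorem 4.1 (radial isotropic position; named fact, NOT proved here).**
Let `u : X → ℝ^k` be a finite family with `|X| ≥ k` such that every sub-family with at most `k`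
members is linearly independent.  Then there is a nonsingular `k × k` matrix `A` with
`∑_x (A u_x)(A u_x)ᵀ/‖A u_x‖² = (|X|/k)·I_k`, stated as the equality of the two quadratic forms
`w ↦ ∑_x ⟨A u_x, w⟩²/‖A u_x‖²` and `w ↦ (|X|/k)‖w‖²` (equivalent for symmetric matrices).  Forster's
proof: an eigenvalue-raising step (Lemma 4.1) iterated to a maximum of the smallest eigenvalue over
a compact set of maps (Lemma 4.2).  Consumers take `(hI : ForsterIsotropicPosition)`.
[cite: Forster2002, Theorem 4.1] [file Computability/Complexity/ForsterIsotropicPosition] -/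
def ForsterIsotropicPosition : Prop :=
  ∀ (X : Type) [Fintype X] (k : ℕ) (u : X → Fin k → ℝ), k ≤ Fintype.card X →
    (∀ S : Finset X, S.card ≤ k → LinearIndepOn ℝ u (S : Set X)) →
    ∃ A : Matrix (Fin k) (Fin k) ℝ, IsUnit A.det ∧ ∀ w : Fin k → ℝ,
      ∑ x, (A *ᵥ u x ⬝ᵥ w) ^ 2 / (A *ᵥ u x ⬝ᵥ A *ᵥ u x) =
        (Fintype.card X : ℝ) / k * (w ⬝ᵥ w)

end Literature.Computability.Complexity
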